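import Mathlib
import Summits.ValiantsHypothesis.ValiantsHypothesis.Theorems.RigidityForcesSymmetryRankRigidMinimalReprLaplaceFiveStarProfile
import Summits.ValiantsHypothesis.ValiantsHypothesis.Theorems.RigidityForcesSymmetryRankRigidMinimalReprLaplaceFiveStarSlackSum
import Summits.ValiantsHypothesis.ValiantsHypothesis.Theorems.RigidityForcesSymmetryRankRigidMinimalReprLaplaceFiveStarRankObstruction
import Summits.ValiantsHypothesis.ValiantsHypothesis.Theorems.RigidityForcesSymmetryRankRigidMinimalReprLaplaceFiveStarRowRelationsFine
import Summits.ValiantsHypothesis.ValiantsHypothesis.Theorems.RigidityForcesSymmetryRankRigidMinimalReprLaplaceFiveStarLetterReading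
import Summits.ValiantsHypothesis.ValiantsHypothesis.Theorems.RigidityForcesSymmetryRankRigidMinimalReprLaplaceFiveStarLetterPoly
import Summits.ValiantsHypothesis.ValiantsHypothesis.Theorems.RigidityForcesSymmetryRankRigidMinimalReprLaplaceFiveStarEngine
import Summits.ValiantsHypothesis.ValiantsHypothesis.Theorems.RigidityForcesSymmetryRankRigidMinimalReprLaplaceFiveStarAssemblyTools

/-!
# ValiantsHypothesis / RigidityForcesSymmetry — crux `LaplaceOptimalFive` (stmt-ValiantsHypothesis-24813), crux idea
`young-shadow` (K1) on the star: **ENGINE INPUTS OF A TWO-TERM FIBRE** (wiring for `star_main`)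
(memo `NOTE-p4g16-24813-LemmaK-kernel.md`)

`fibre_inputs`: for a two-term fibre `F = {t₁,t₂}` of a star decomposition read in letter currency (✓ `star_letter_reading`):
the pair form of the fibre sum, the `3+3` exchange identity (✓ `exchange33_of_closed44`) and the polynomial slack in the form
consumed by ✓ `two_term_engine` (✓ `slack_poly`, ✓ `cubicMatrix_of_fibre`, ✓ `quintic_of_fibre`).

No definitions, no `sorry`.  Honest framing: K1 ON THE STAR only (side-symmetric sector, pair splits, four splits with a hub); not a registered stub of
`LaplaceOptimalFive` — helper, closes nothing; `LaplaceOptimalFive` OPEN · CONTESTED 72/120; `VP ≠ VNP` NOT proved.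
-/

set_option linter.dupNamespace false

namespace Summit.ValiantsHypothesis.ValiantsHypothesis.Theorems.RigidityForcesSymmetryRankRigidMinimalRepr

namespace LaplaceFiveStar

open Finset MvPolynomial Module LaplaceFiveSectorSplit

variable {N : ℕ}

/-- **Engine inputs of a two-term fibre**: pair form, `3+3` exchange identity, and the polynomial slack in engine form.
[folklore] -/
theorem fibre_inputs (T F : Finset (Fin N)) (hFT : F ⊆ T)
    (U : Fin N → Fin 5 → Fin 5 → ℂ) (W : Fin N → Fin 5 → Fin 5 → Fin 5 → ℂ)
    (hsymm : ∀ t ∈ T, (∀ y z : Fin 5, U t y z = U t z y) ∧ (∀ y z o : Fin 5, W t y z o = W t z y o) ∧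
      (∀ y z o : Fin 5, W t y z o = W t y o z))
    (t₁ t₂ : Fin N) (h12 : t₁ ≠ t₂) (hF : F = {t₁, t₂})
    (hC : ∀ A B C D E : Fin 5,
      (∑ t ∈ F, U t A B * W t C D E) + (∑ t ∈ F, U t A C * W t B D E) + (∑ t ∈ F, U t A D * W t C B E)
        + (∑ t ∈ F, U t A E * W t C D B)
      = (∑ t ∈ F, U t B A * W t C D E) + (∑ t ∈ F, U t B C * W t A D E) + (∑ t ∈ F, U t B D * W t C A E)
        + (∑ t ∈ F, U t B E * W t C D A))
    (EL : Fin 5 → Fin 5 → Fin 5 → Fin 5 → Fin 5 → ℂ)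
    (hEL : ∀ A B C D E : Fin 5, EL A B C D E = (∑ t ∈ F, U t A B * W t C D E) - (1 / 10 : ℂ) *
      ((∑ t ∈ F, U t A B * W t C D E) + (∑ t ∈ F, U t A C * W t B D E) + (∑ t ∈ F, U t A D * W t B C E)
        + (∑ t ∈ F, U t A E * W t B C D) + (∑ t ∈ F, U t B C * W t A D E) + (∑ t ∈ F, U t B D * W t A C E)
        + (∑ t ∈ F, U t B E * W t A C D) + (∑ t ∈ F, U t C D * W t A B E) + (∑ t ∈ F, U t C E * W t A B D)
        + (∑ t ∈ F, U t D E * W t A B C)))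
    (Epoly : Fin 5 → Fin 5 → MvPolynomial (Fin 5) ℂ)
    (hEpoly : ∀ A B : Fin 5, Epoly A B = ∑ c : Fin 5, ∑ d : Fin 5, ∑ e : Fin 5, C (EL A B c d e) * X c * X d * X e) :
    (∀ x y z w v : Fin 5, (∑ t ∈ F, U t x y * W t z w v) = U t₁ x y * W t₁ z w v + U t₂ x y * W t₂ z w v) ∧
    (∀ A B C D E : Fin 5,
      (U t₁ A C * W t₁ B D E + U t₁ A D * W t₁ B C E + U t₁ A E * W t₁ B C D)
        + (U t₂ A C * W t₂ B D E + U t₂ A D * W t₂ B C E + U t₂ A E * W t₂ B C D)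
      = (U t₁ B C * W t₁ A D E + U t₁ B D * W t₁ A C E + U t₁ B E * W t₁ A C D)
        + (U t₂ B C * W t₂ A D E + U t₂ B D * W t₂ A C E + U t₂ B E * W t₂ A C D)) ∧
    (∀ A B : Fin 5, Epoly A B
      = C (U t₁ A B) * (∑ x : Fin 5, ∑ w : Fin 5, ∑ u : Fin 5, C (W t₁ x w u) * X x * X w * X u)
        + C (U t₂ A B) * (∑ x : Fin 5, ∑ w : Fin 5, ∑ u : Fin 5, C (W t₂ x w u) * X x * X w * X u)
        - C (1 / 20 : ℂ) * pderiv A (pderiv B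
          ((∑ x : Fin 5, ∑ w : Fin 5, C (U t₁ x w) * X x * X w) * (∑ x : Fin 5, ∑ w : Fin 5, ∑ u : Fin 5, C (W t₁ x w u) * X x * X w * X u)
          + (∑ x : Fin 5, ∑ w : Fin 5, C (U t₂ x w) * X x * X w) * (∑ x : Fin 5, ∑ w : Fin 5, ∑ u : Fin 5, C (W t₂ x w u) * X x * X w * X u)))) := by
  have ht₁ : t₁ ∈ T := hFT (by rw [hF]; simp)
  have ht₂ : t₂ ∈ T := hFT (by rw [hF]; simp)
  have pair : ∀ x y z w v : Fin 5, (∑ t ∈ F, U t x y * W t z w v) = U t₁ x y * W t₁ z w v + U t₂ x y * W t₂ z w v :=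
    fun x y z w v => by rw [hF, Finset.sum_pair h12]
  obtain ⟨hU1, hW1a, hW1b⟩ := hsymm t₁ ht₁
  obtain ⟨hU2, hW2a, hW2b⟩ := hsymm t₂ ht₂
  have hC33 := exchange33_of_closed44 (U t₁) (U t₂) (W t₁) (W t₂) hU1 hU2 hW1a hW1b hW2a hW2b (fun A B C D E => by
    have h := hC A B C D E
    simp only [pair] at h
    exact h)
  refine ⟨pair, hC33, fun A B => ?_⟩
  -- symmetries of the fibre tensor
  set H : Fin 5 → Fin 5 → Fin 5 → Fin 5 → Fin 5 → ℂ := fun A B C D E => ∑ t ∈ F, U t A B * W t C D E with hH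
  have Hsym : ∀ t ∈ F, (∀ y z : Fin 5, U t y z = U t z y) ∧ (∀ y z o : Fin 5, W t y z o = W t z y o) ∧
      (∀ y z o : Fin 5, W t y z o = W t y o z) := fun t ht => hsymm t (hFT ht)
  have s12 : ∀ a b c d e : Fin 5, H a b c d e = H b a c d e := fun a b c d e =>
    Finset.sum_congr rfl fun t ht => by rw [(Hsym t ht).1]
  have s34 : ∀ a b c d e : Fin 5, H a b c d e = H a b d c e := fun a b c d e =>
    Finset.sum_congr rfl fun t ht => by rw [(Hsym t ht).2.1]
  have s45 : ∀ a b c d e : Fin 5, H a b c d e = H a b c e d := fun a b c d e =>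
    Finset.sum_congr rfl fun t ht => by rw [(Hsym t ht).2.2]
  have hsl := slack_poly H s12 s34 s45 A B
  simp only [hH] at hsl
  rw [hEpoly]
  simp only [hEL]
  rw [hsl, cubicMatrix_of_fibre, quintic_of_fibre, hF, Finset.sum_pair h12, Finset.sum_pair h12]

end LaplaceFiveStar

end Summit.ValiantsHypothesis.ValiantsHypothesis.Theorems.RigidityForcesSymmetryRankRigidMinimalRepr
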